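import Summits.HodgeConjecture.CorCM.IrreducibleOddWeightsDichotomy
import Mathlib.RepresentationTheory.Irreducible
import HarnessLib

/-!
# Covering families of irreducibles always exist: `ℚ^X` decomposes into irreducible stable subspaces with
# equivariant projections, and one representative per isomorphism class covers every stable subspace

COR-CM (cell `pub-hodgecm2`, binder seat `b16` gen 59, count-neutral claim INDEX BOUND, file F2 — abstract `G`-set level;
theorems only, no definition, no named fact, no `sorry`).  NEW as stated (as a packaged existence statement in the
tree's vocabulary), hence under `Summits/`; mathematically this is complete reducibility of the permutation module
`ℚ^X` of a finite `G`-set.  HONEST FRAMING: finite-dimensional linear algebra over `ℚ`; `HC_CM` is neither used nor asserted.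

WHY.  The finite nondegeneracy tests of gen 57/58 (`…MultiplicityCriterionFamilies`, `…Helly`,
`…IndexBound`) are stated for a COVERING LIST of pairwise non-isomorphic irreducible `ℚ`-representations `(π_k, V_k)`
of `G`: every non-zero stable `P ≤ U(Φ_i)` admits an equivariant `T : ℚ^{E_i} → V_k` with `T(P) ≠ 0`.  Gen 58 produced
such lists from Wedderburn certificates.  Here we prove that a covering list EXISTS for every group `G` acting on a
finite set `X` (no finiteness of `G`, no certificate), so that purely structural consequences — the Helly number is at
most the index of an abelian subgroup, F3 `…IndexHelly` — can be stated with NO representation in sight.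

* §1 **`exists_irreducible_decomposition`**: every `G`-stable `P ≤ ℚ^X` carries finitely many irreducible stable
  subspaces `S_j ≤ P` and `G`-equivariant endomorphisms `p_j` of `ℚ^X` with values in `S_j` such that `Σ_j p_j = id`
  on `P` (induction on `dim P`: split off a stable subspace of minimal dimension with the equivariant orthogonal
  projection of gen 55, `IrrOdd.exists_equivariant_projection`).
* §2 **`exists_covering_irreducibles`**: there are stable subspaces `S_j ≤ ℚ^X` with their restricted permutation
  representations `π_j` (all irreducible) and a set `K` of indices, ONE PER ISOMORPHISM CLASS, such that the `π_k`,
  `k ∈ K`, are pairwise disjoint (no non-zero intertwiner) and cover every non-zero stable `P ≤ ℚ^X`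
  (some `p_j` is non-zero on `P`; compose with `S_j ≅ S_{k}` for the representative `k` of the class of `j`).
* §3 **`exists_covering_irreducibles_slots`**: the same for finitely many slots `E_i` at once — irreducibles inside
  `ℚ^{⊔_i E_i}` covering every non-zero stable `P ≤ ℚ^{E_i}` of every slot (through the extension by zero `ext_i`),
  exactly the hypothesis `hcov` of the gen-57/58 criteria; if a subgroup `A ≤ G` acts on every slot through pairwise
  commuting permutations, it acts on every `V_k` through pairwise commuting operators (the hypothesis of the index bound).

## References

* [Serre1977] J.-P. Serre, *Linear Representations of Finite Groups*, GTM 42 (1977), §1.3 Thm. 1, §1.4 Thm. 2 (complete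
  reducibility), §2.2 Prop. 4 (Schur), §2.6 (canonical decomposition).
* [Mai1989] L. Mai, *Lower bounds for the ranks of CM types*, J. Number Theory 32 (1989), §2 Prop. 1 (proof).
* [Deligne1982HodgeCycles] P. Deligne, *Hodge cycles on abelian varieties*, LNM 900 (1982), I Ex. 3.7.
-/

set_option autoImplicit false

noncomputable section

open scoped BigOperators

universe u v w

namespace Summit.HodgeConjecture.CorCM.IrrOdd

open Literature.NumberTheory.ComplexMultiplication

variable {G : Type w} [Group G] {X : Type v} [MulAction G X] [Fintype X]

/-! ### §1 Decomposition of a stable subspace into irreducible stable subspaces with equivariant projections -/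

/-- **COMPLETE REDUCIBILITY OF `ℚ^X`, CONSTRUCTIVELY PACKAGED.**  Every `G`-stable `P ≤ ℚ^X` (`X` a finite `G`-set,
`G` arbitrary) admits finitely many IRREDUCIBLE stable subspaces `S_j ≤ P` (non-zero, every non-zero stable subspace
of `S_j` is `S_j`) and `G`-equivariant endomorphisms `p_j` of `ℚ^X` with `p_j(ℚ^X) ≤ S_j` and `Σ_j p_j(f) = f` for all
`f ∈ P` (so `P = ⊕_j S_j`).  Induction on `dim P`: a non-zero stable subspace `S₀ ≤ P` of minimal dimension is
irreducible, the orthogonal projection `Q` onto it is equivariant (gen 55), and `P ∩ ker Q` is stable of smaller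
dimension. [cite: Serre1977, §1.3 Thm. 1 and §1.4 Thm. 2] -/
theorem exists_irreducible_decomposition (P : Submodule ℚ (X → ℚ))
    (hP : ∀ (g : G) (f : X → ℚ), f ∈ P → (fun x => f (g • x)) ∈ P) :
    ∃ (n : ℕ) (S : Fin n → Submodule ℚ (X → ℚ)) (p : Fin n → ((X → ℚ) →ₗ[ℚ] (X → ℚ))),
      (∀ j, S j ≤ P) ∧
      (∀ j (g : G) (f : X → ℚ), f ∈ S j → (fun x => f (g • x)) ∈ S j) ∧
      (∀ j, S j ≠ ⊥) ∧
      (∀ j (W : Submodule ℚ (X → ℚ)), W ≤ S j → W ≠ ⊥ →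
        (∀ (g : G) (f : X → ℚ), f ∈ W → (fun x => f (g • x)) ∈ W) → W = S j) ∧
      (∀ j (g : G) (f : X → ℚ), p j (fun x => f (g⁻¹ • x)) = fun x => p j f (g⁻¹ • x)) ∧
      (∀ j f, p j f ∈ S j) ∧
      ∀ f ∈ P, ∑ j, p j f = f := by
  classical
  suffices key : ∀ (m : ℕ) (P : Submodule ℚ (X → ℚ)), Module.finrank ℚ P ≤ m →
      (∀ (g : G) (f : X → ℚ), f ∈ P → (fun x => f (g • x)) ∈ P) →
      ∃ (n : ℕ) (S : Fin n → Submodule ℚ (X → ℚ)) (p : Fin n → ((X → ℚ) →ₗ[ℚ] (X → ℚ))),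
        (∀ j, S j ≤ P) ∧
        (∀ j (g : G) (f : X → ℚ), f ∈ S j → (fun x => f (g • x)) ∈ S j) ∧
        (∀ j, S j ≠ ⊥) ∧
        (∀ j (W : Submodule ℚ (X → ℚ)), W ≤ S j → W ≠ ⊥ →
          (∀ (g : G) (f : X → ℚ), f ∈ W → (fun x => f (g • x)) ∈ W) → W = S j) ∧
        (∀ j (g : G) (f : X → ℚ), p j (fun x => f (g⁻¹ • x)) = fun x => p j f (g⁻¹ • x)) ∧
        (∀ j f, p j f ∈ S j) ∧
        ∀ f ∈ P, ∑ j, p j f = f from key _ P le_rfl hP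
  -- the empty decomposition of `⊥`
  have hbot : ∀ P : Submodule ℚ (X → ℚ), P = ⊥ →
      ∃ (n : ℕ) (S : Fin n → Submodule ℚ (X → ℚ)) (p : Fin n → ((X → ℚ) →ₗ[ℚ] (X → ℚ))),
        (∀ j, S j ≤ P) ∧
        (∀ j (g : G) (f : X → ℚ), f ∈ S j → (fun x => f (g • x)) ∈ S j) ∧
        (∀ j, S j ≠ ⊥) ∧
        (∀ j (W : Submodule ℚ (X → ℚ)), W ≤ S j → W ≠ ⊥ →
          (∀ (g : G) (f : X → ℚ), f ∈ W → (fun x => f (g • x)) ∈ W) → W = S j) ∧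
        (∀ j (g : G) (f : X → ℚ), p j (fun x => f (g⁻¹ • x)) = fun x => p j f (g⁻¹ • x)) ∧
        (∀ j f, p j f ∈ S j) ∧
        ∀ f ∈ P, ∑ j, p j f = f := by
    rintro P rfl
    refine ⟨0, Fin.elim0, Fin.elim0, fun j => j.elim0, fun j => j.elim0, fun j => j.elim0, fun j => j.elim0,
      fun j => j.elim0, fun j => j.elim0, fun f hf => ?_⟩
    rw [(Submodule.mem_bot ℚ).1 hf, Finset.sum_eq_zero fun j _ => j.elim0]
  intro m
  induction m with
  | zero =>
    intro P hPm hP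
    exact hbot P (Submodule.finrank_eq_zero.1 (Nat.le_zero.1 hPm))
  | succ m ih =>
    intro P hPm hP
    by_cases hP0 : P = ⊥
    · exact hbot P hP0
    -- a non-zero stable subspace `S₀ ≤ P` of minimal dimension: irreducible
    have hex : ∃ d, ∃ S : Submodule ℚ (X → ℚ), S ≤ P ∧ S ≠ ⊥ ∧
        (∀ (g : G) (f : X → ℚ), f ∈ S → (fun x => f (g • x)) ∈ S) ∧ Module.finrank ℚ S = d :=
      ⟨_, P, le_rfl, hP0, hP, rfl⟩
    obtain ⟨S₀, hS₀P, hS₀0, hS₀st, hS₀d⟩ := Nat.find_spec hex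
    have hS₀irr : ∀ W : Submodule ℚ (X → ℚ), W ≤ S₀ → W ≠ ⊥ →
        (∀ (g : G) (f : X → ℚ), f ∈ W → (fun x => f (g • x)) ∈ W) → W = S₀ := by
      intro W hW hW0 hWst
      refine Submodule.eq_of_le_of_finrank_le hW ?_
      rw [hS₀d]
      exact Nat.find_min' hex ⟨W, hW.trans hS₀P, hW0, hWst, rfl⟩
    -- the equivariant projection onto `S₀` and the stable complement `P' = P ∩ ker Q`
    obtain ⟨Q, hQeq, hQS, hQid⟩ := exists_equivariant_projection (G := G) S₀ hS₀st
    let P' : Submodule ℚ (X → ℚ) := P ⊓ LinearMap.ker Q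
    have hP'st : ∀ (g : G) (f : X → ℚ), f ∈ P' → (fun x => f (g • x)) ∈ P' := by
      intro g f hf
      obtain ⟨hfP, hfQ⟩ := Submodule.mem_inf.1 hf
      refine Submodule.mem_inf.2 ⟨hP g f hfP, ?_⟩
      rw [LinearMap.mem_ker] at hfQ ⊢
      have h1 := hQeq g⁻¹ f
      rw [inv_inv] at h1
      rw [h1, hfQ]
      rfl
    have hP'lt : Module.finrank ℚ P' ≤ m := by
      obtain ⟨s, hs, hs0⟩ := Submodule.exists_mem_ne_zero_of_ne_bot hS₀0
      have hlt : P' < P := by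
        refine lt_of_le_of_ne inf_le_left fun h => hs0 ?_
        have hsP' : s ∈ P' := h ▸ hS₀P hs
        have h2 : Q s = 0 := LinearMap.mem_ker.1 (Submodule.mem_inf.1 hsP').2
        rwa [hQid s hs] at h2
      have := Submodule.finrank_lt_finrank_of_lt hlt
      omega
    obtain ⟨n', S', p', h1', h2', h3', h4', h5', h6', h7'⟩ := ih P' hP'lt hP'st
    -- the new decomposition: `S₀` in front
    refine ⟨n' + 1, Fin.cons S₀ S', Fin.cons Q fun j => p' j ∘ₗ (LinearMap.id - Q), fun j => ?_, fun j => ?_,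
      fun j => ?_, fun j => ?_, fun j => ?_, fun j => ?_, fun f hf => ?_⟩
    · refine Fin.cases ?_ (fun j => ?_) j
      · simpa only [Fin.cons_zero] using hS₀P
      · simpa only [Fin.cons_succ] using (h1' j).trans inf_le_left
    · refine Fin.cases ?_ (fun j => ?_) j
      · simpa only [Fin.cons_zero] using hS₀st
      · simpa only [Fin.cons_succ] using h2' j
    · refine Fin.cases ?_ (fun j => ?_) j
      · simpa only [Fin.cons_zero] using hS₀0
      · simpa only [Fin.cons_succ] using h3' j
    · refine Fin.cases ?_ (fun j => ?_) j
      · simpa only [Fin.cons_zero] using hS₀irr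
      · simpa only [Fin.cons_succ] using h4' j
    · refine Fin.cases ?_ (fun j => ?_) j
      · simpa only [Fin.cons_zero] using hQeq
      · intro g f
        simp only [Fin.cons_succ, LinearMap.comp_apply, LinearMap.sub_apply, LinearMap.id_apply]
        have hsub : (f - Q f : X → ℚ) = fun x => f x - Q f x := rfl
        have h1 : ((fun x => f (g⁻¹ • x)) - Q (fun x => f (g⁻¹ • x)) : X → ℚ) =
            fun x => (f - Q f : X → ℚ) (g⁻¹ • x) := by
          rw [hQeq g f]
          rfl
        rw [h1, h5' j g (f - Q f)]
    · refine Fin.cases ?_ (fun j => ?_) j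
      · simpa only [Fin.cons_zero] using hQS
      · intro f
        simpa only [Fin.cons_succ, LinearMap.comp_apply, LinearMap.sub_apply, LinearMap.id_apply] using
          h6' j (f - Q f)
    · rw [Fin.sum_univ_succ]
      simp only [Fin.cons_zero, Fin.cons_succ, LinearMap.comp_apply, LinearMap.sub_apply, LinearMap.id_apply]
      have hf' : f - Q f ∈ P' := by
        refine Submodule.mem_inf.2 ⟨P.sub_mem hf (hS₀P (hQS f)), ?_⟩
        rw [LinearMap.mem_ker, map_sub, hQid _ (hQS f), sub_self]
      rw [h7' _ hf', add_sub_cancel]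

/-! ### §2 One representative per isomorphism class: a covering list of pairwise disjoint irreducibles -/

/-- **A COVERING LIST OF PAIRWISE DISJOINT IRREDUCIBLES EXISTS** (for any group `G` acting on a finite set `X`):
there are `G`-stable subspaces `S_j ≤ ℚ^X` whose restricted permutation representations `π_j`
(`(π_j(g) s)(x) = s(g⁻¹x)`) are irreducible, and a set `K` of indices such that the `π_k`, `k ∈ K`, admit no non-zero
intertwiner between different members and COVER every non-zero stable `P ≤ ℚ^X`: some equivariant
`T : ℚ^X → S_k`, `k ∈ K`, is non-zero on `P`.  (§1 for `P = ℚ^X`, then one index per isomorphism class of the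
`π_j`; two representatives with a non-zero intertwiner would be isomorphic by Schur.)
[cite: Serre1977, §1.4 Thm. 2, §2.2 Prop. 4 and §2.6] -/
theorem exists_covering_irreducibles :
    ∃ (n : ℕ) (S : Fin n → Submodule ℚ (X → ℚ)) (π : ∀ j, Representation ℚ G (S j)) (K : Finset (Fin n)),
      (∀ j (g : G) (s : S j) (x : X), ((π j g s : S j) : X → ℚ) x = (s : X → ℚ) (g⁻¹ • x)) ∧
      (∀ j, (π j).IsIrreducible) ∧
      (∀ k ∈ K, ∀ l ∈ K, k ≠ l → ∀ T : (π k).IntertwiningMap (π l), T = 0) ∧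
      ∀ P : Submodule ℚ (X → ℚ), P ≠ ⊥ → (∀ (g : G) (f : X → ℚ), f ∈ P → (fun x => f (g • x)) ∈ P) →
        ∃ k ∈ K, ∃ T : (X → ℚ) →ₗ[ℚ] S k,
          (∀ (g : G) (f : X → ℚ), T (fun x => f (g⁻¹ • x)) = π k g (T f)) ∧ ∃ f ∈ P, T f ≠ 0 := by
  classical
  obtain ⟨n, S, p, -, hSst, hS0, hSirr, hpeq, hpS, hsum⟩ :=
    exists_irreducible_decomposition (G := G) (⊤ : Submodule ℚ (X → ℚ)) fun _ _ _ => Submodule.mem_top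
  -- the permutation representation and its restrictions
  let σ : Representation ℚ G (X → ℚ) :=
    { toFun := fun g => LinearMap.funLeft ℚ ℚ fun x : X => g⁻¹ • x
      map_one' := by ext f x; simp
      map_mul' := fun g h => by ext f x; simp [mul_smul] }
  have hσ : ∀ (g : G) (f : X → ℚ), σ g f = fun x => f (g⁻¹ • x) := fun g f => rfl
  have hle : ∀ j (g : G), S j ≤ (S j).comap (σ g) := fun j g f hf => by
    rw [Submodule.mem_comap, hσ]
    exact hSst j g⁻¹ f hf
  let π : ∀ j, Representation ℚ G (S j) := fun j => σ.subrepresentation (S j) (hle j)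
  have hπ : ∀ j (g : G) (s : S j) (x : X), ((π j g s : S j) : X → ℚ) x = (s : X → ℚ) (g⁻¹ • x) :=
    fun j g s x => rfl
  -- irreducibility of the restrictions
  have hirr : ∀ j, (π j).IsIrreducible := by
    intro j
    obtain ⟨s₀, hs₀, hs₀0⟩ := Submodule.exists_mem_ne_zero_of_ne_bot (hS0 j)
    haveI : Nontrivial (Subrepresentation (π j)) := ⟨⊥, ⊤, fun h => hs₀0 (by
      have hmem : (⟨s₀, hs₀⟩ : S j) ∈ (⊤ : Subrepresentation (π j)).toSubmodule := Submodule.mem_top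
      rw [← h] at hmem
      have h0 : (⟨s₀, hs₀⟩ : S j) = 0 := (Submodule.mem_bot ℚ).1 hmem
      exact congrArg Subtype.val h0)⟩
    refine ⟨fun W => ?_⟩
    let W' : Submodule ℚ (X → ℚ) := W.toSubmodule.map (S j).subtype
    have hW'le : W' ≤ S j := by
      rintro _ ⟨w, -, rfl⟩
      exact w.2
    have hW'st : ∀ (g : G) (f : X → ℚ), f ∈ W' → (fun x => f (g • x)) ∈ W' := by
      rintro g _ ⟨w, hw, rfl⟩
      refine ⟨π j g⁻¹ w, W.apply_mem_toSubmodule g⁻¹ hw, funext fun x => ?_⟩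
      rw [Submodule.coe_subtype, hπ, inv_inv]
    by_cases hW'0 : W' = ⊥
    · left
      apply Subrepresentation.toSubmodule_injective
      change W.toSubmodule = ⊥
      have hinj := Submodule.map_injective_of_injective (S j).injective_subtype
      apply hinj
      change W' = Submodule.map (S j).subtype ⊥
      rw [hW'0, Submodule.map_bot]
    · right
      apply Subrepresentation.toSubmodule_injective
      change W.toSubmodule = ⊤
      have hinj := Submodule.map_injective_of_injective (S j).injective_subtype
      apply hinj
      change W' = Submodule.map (S j).subtype ⊤
      rw [Submodule.map_subtype_top, hSirr j W' hW'le hW'0 hW'st]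
  -- one representative per isomorphism class
  letI rel : Setoid (Fin n) := ⟨fun j j' => Nonempty ((π j).Equiv (π j')),
    ⟨fun j => ⟨Representation.Equiv.refl (π j)⟩, fun ⟨e⟩ => ⟨e.symm⟩, fun ⟨e⟩ ⟨e'⟩ => ⟨e.trans e'⟩⟩⟩
  let rep : Fin n → Fin n := fun j => (Quotient.mk rel j).out
  have hrep : ∀ j, Nonempty ((π (rep j)).Equiv (π j)) := fun j => Quotient.mk_out j
  have hrep_mk : ∀ j, Quotient.mk rel (rep j) = Quotient.mk rel j := fun j => Quotient.out_eq _
  let K : Finset (Fin n) := Finset.univ.image rep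
  refine ⟨n, S, π, K, hπ, hirr, fun k hk l hl hkl T => ?_, fun P hP0 hPst => ?_⟩
  · -- representatives with a non-zero intertwiner are isomorphic, hence equal
    obtain ⟨j, -, rfl⟩ := Finset.mem_image.1 hk
    obtain ⟨j', -, rfl⟩ := Finset.mem_image.1 hl
    haveI := hirr (rep j)
    haveI := hirr (rep j')
    rcases Representation.IsIrreducible.bijective_or_eq_zero T with hT | hT
    · exfalso
      apply hkl
      have hiso : Quotient.mk rel (rep j) = Quotient.mk rel (rep j') :=
        Quotient.sound ⟨Representation.IntertwiningMap.ofBijective T hT⟩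
      change (Quotient.mk rel j).out = (Quotient.mk rel j').out
      rw [← hrep_mk j, ← hrep_mk j', hiso]
    · exact hT
  · -- covering: some `p_j` is non-zero on `P`; move to the representative of `j`
    obtain ⟨j, f, hfP, hjf⟩ : ∃ j, ∃ f ∈ P, p j f ≠ 0 := by
      by_contra hall
      push Not at hall
      apply hP0
      rw [Submodule.eq_bot_iff]
      intro f hf
      rw [← hsum f Submodule.mem_top]
      exact Finset.sum_eq_zero fun j _ => hall j f hf
    obtain ⟨e⟩ := hrep j
    let pj : (X → ℚ) →ₗ[ℚ] S j := LinearMap.codRestrict (S j) (p j) (hpS j)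
    have hpj : ∀ (g : G) (f : X → ℚ), pj (fun x => f (g⁻¹ • x)) = π j g (pj f) := fun g f =>
      Subtype.ext (by
        change p j (fun x => f (g⁻¹ • x)) = fun x => p j f (g⁻¹ • x)
        exact hpeq j g f)
    refine ⟨rep j, Finset.mem_image_of_mem rep (Finset.mem_univ j), e.symm.toLinearMap ∘ₗ pj, fun g f' => ?_,
      f, hfP, fun h0 => hjf ?_⟩
    · rw [LinearMap.comp_apply, LinearMap.comp_apply, hpj]
      exact Representation.IntertwiningMap.isIntertwining _ _ e.symm.toIntertwiningMap g (pj f')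
    · have h1 : pj f = 0 := by
        have h2 : e.symm.toLinearEquiv (pj f) = 0 := h0
        exact (LinearEquiv.map_eq_zero_iff _).1 h2
      exact congrArg Subtype.val h1

/-! ### §3 Finitely many slots at once -/

section Slots

variable {I : Type u} {E : I → Type v} [∀ i, MulAction G (E i)] [Fintype I] [∀ i, Fintype (E i)] [DecidableEq I]

/-- **COVERING IRREDUCIBLES FOR FINITELY MANY SLOTS** — exactly the hypothesis `hcov` of the gen-57/58 criteria
(`…MultiplicityCriterionFamilies`, `…Helly`): inside `ℚ^{⊔_i E_i}` there are `G`-stable subspaces `S_j` with their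
(irreducible) restricted permutation representations `π_j` and a set `K` of indices such that the `π_k`, `k ∈ K`, admit
no non-zero intertwiner between different members and cover every non-zero stable `P ≤ ℚ^{E_i}` of EVERY slot: some
equivariant `T : ℚ^{E_i} → S_k`, `k ∈ K`, is non-zero on `P` (§2 on `X = ⊔_i E_i`, through the extension by zero
`ext_i : ℚ^{E_i} → ℚ^{⊔ E}`). [cite: Serre1977, §1.4 Thm. 2, §2.2 Prop. 4 and §2.6] [cite: Mai1989, §2 Prop. 1 (proof)] -/
theorem exists_covering_irreducibles_slots :
    ∃ (n : ℕ) (S : Fin n → Submodule ℚ ((Σ i, E i) → ℚ)) (π : ∀ j, Representation ℚ G (S j)) (K : Finset (Fin n)),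
      (∀ j (g : G) (s : S j) (x : Σ i, E i), ((π j g s : S j) : (Σ i, E i) → ℚ) x = (s : (Σ i, E i) → ℚ) (g⁻¹ • x)) ∧
      (∀ j, (π j).IsIrreducible) ∧
      (∀ k ∈ K, ∀ l ∈ K, k ≠ l → ∀ T : (π k).IntertwiningMap (π l), T = 0) ∧
      ∀ (i : I) (P : Submodule ℚ (E i → ℚ)), P ≠ ⊥ →
        (∀ (g : G) (a : E i → ℚ), a ∈ P → (fun s => a (g • s)) ∈ P) →
        ∃ k ∈ K, ∃ T : (E i → ℚ) →ₗ[ℚ] S k,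
          (∀ (g : G) (a : E i → ℚ), T (fun s => a (g⁻¹ • s)) = π k g (T a)) ∧ ∃ a ∈ P, T a ≠ 0 := by
  obtain ⟨n, S, π, K, hπ, hirr, hne, hcov⟩ := exists_covering_irreducibles (G := G) (X := Σ i, E i)
  refine ⟨n, S, π, K, hπ, hirr, hne, fun i P hP0 hPst => ?_⟩
  -- `ext_i` is equivariant and injective
  have hext : ∀ (g : G) (a : E i → ℚ),
      (fun x : Σ j, E j => slotExt (E := E) i a (g • x)) = slotExt (E := E) i fun s => a (g • s) := by
    intro g a
    funext x
    obtain ⟨j, s⟩ := x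
    change slotExt i a ⟨j, g • s⟩ = _
    by_cases hji : j = i
    · subst hji
      rw [slotExt_apply_same, slotExt_apply_same]
    · rw [slotExt_apply_of_ne hji, slotExt_apply_of_ne hji]
  have hinj : ∀ a : E i → ℚ, slotExt (E := E) i a = 0 → a = 0 := fun a ha => funext fun s => by
    rw [← slotExt_apply_same (E := E) i a s, ha]
    rfl
  -- cover `ext_i(P)`
  have hP'0 : P.map (slotExt (E := E) i) ≠ ⊥ := by
    obtain ⟨a, haP, ha0⟩ := Submodule.exists_mem_ne_zero_of_ne_bot hP0
    intro h
    exact ha0 (hinj a ((Submodule.mem_bot ℚ).1 (h ▸ Submodule.mem_map_of_mem haP)))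
  have hP'st : ∀ (g : G) (f : (Σ j, E j) → ℚ), f ∈ P.map (slotExt (E := E) i) →
      (fun x => f (g • x)) ∈ P.map (slotExt (E := E) i) := by
    rintro g _ ⟨a, haP, rfl⟩
    exact ⟨fun s => a (g • s), hPst g a haP, (hext g a).symm⟩
  obtain ⟨k, hk, T, hT, f, hf, hf0⟩ := hcov _ hP'0 hP'st
  obtain ⟨a, haP, rfl⟩ := hf
  refine ⟨k, hk, T ∘ₗ slotExt (E := E) i, fun g b => ?_, a, haP, hf0⟩
  rw [LinearMap.comp_apply, LinearMap.comp_apply, ← hext g⁻¹ b, hT]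

omit [Fintype I] [∀ i, Fintype (E i)] [DecidableEq I] in
/-- **Commuting permutations give commuting operators**: if the elements of `A ≤ G` act on every slot through pairwise
commuting permutations, they act on every stable `S ≤ ℚ^{⊔_i E_i}` through pairwise commuting operators of the
restricted permutation representation — the hypothesis of the index bound `…IndexBound`. [folklore] -/
theorem commute_of_smul_comm {S : Submodule ℚ ((Σ i, E i) → ℚ)} (π : Representation ℚ G S)
    (hπ : ∀ (g : G) (s : S) (x : Σ i, E i), ((π g s : S) : (Σ i, E i) → ℚ) x = (s : (Σ i, E i) → ℚ) (g⁻¹ • x))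
    (A : Subgroup G) (hA : ∀ a ∈ A, ∀ b ∈ A, ∀ (i : I) (s : E i), a • b • s = b • a • s) :
    ∀ a ∈ A, ∀ b ∈ A, π a * π b = π b * π a := by
  intro a ha b hb
  refine LinearMap.ext fun s => Subtype.ext (funext fun x => ?_)
  obtain ⟨i, t⟩ := x
  rw [Module.End.mul_apply, Module.End.mul_apply, hπ, hπ, hπ, hπ]
  change (s : (Σ i, E i) → ℚ) ⟨i, b⁻¹ • a⁻¹ • t⟩ = (s : (Σ i, E i) → ℚ) ⟨i, a⁻¹ • b⁻¹ • t⟩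
  rw [hA b⁻¹ (A.inv_mem hb) a⁻¹ (A.inv_mem ha) i t]

end Slots

end Summit.HodgeConjecture.CorCM.IrrOdd

end
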